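import Summits.KontsevichZagierPeriods.KontsevichZagierPeriods.Theorems.LinRedNormalFormArrangementNormalFormSeparateTwoNormEquiv
import Summits.KontsevichZagierPeriods.KontsevichZagierPeriods.Theorems.LinRedNormalFormArrangementNormalFormSeparateTwoMonoSplit

/-!
# The monomial split under an almost-decreasing weight in three variables

(Line `janus-bands`, crux `ArrangementNormalForm`, stub `stub_separateHigh`, part `HHKMonoSplit` of
the wall-invariant termwise-split lemma `separateThree_hHk` in base dimension `3` with fibres.)
The local analysis of the Taylor pieces at a base point of `ℝ³` uses NESTED thin sectors with
blown-up coordinates `(t, v, u)` and a weight `W ≥ 0` on `(0, 4δ) × (0, 4ε) × (0, 4η)` that is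
ALMOST DECREASING TOWARDS THE CORNER at scale `4` in each variable
(`W(t, v, u) ≤ K · W(t', v', u')` for `t ≤ t' ≤ 4t`, `v ≤ v' ≤ 4v`, `u ≤ u' ≤ 4u`). This file proves
the three-variable monomial split `monoSplit₃` (registered as `separateThreeHHK_monoSplit`): if a
polynomial `∑ c i j l t^i v^j u^l` is absolutely `W`-integrable on the big box then every
monomial `c i j l t^i v^j u^l` is, on `(0, δ) × (0, ε) × (0, η)`. It is obtained by iterating a
QUANTITATIVE one-variable split (`monoSplit₁_le`: norm equivalence on `[x, 4x]`, part `NormEquiv`,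
and the window average of part `MonoSplit`) in `u`, then `v`, then `t`, with Tonelli in between.
-/

noncomputable section

open Set MeasureTheory
open scoped ENNReal

namespace Summit.KontsevichZagierPeriods.ArrangementNormalForm.JanusBands

namespace SepHHK

open SepTwo

variable {d : ℕ}

/-! ### One variable, quantitative -/

/-- Rescaling the variable rescales the coefficients. -/
theorem pev_scale (c : Fin (d + 1) → ℝ) (x ξ : ℝ) :
    pev c (x * ξ) = pev (fun i => c i * x ^ (i : ℕ)) ξ := by
  unfold pev
  refine Finset.sum_congr rfl fun i _ => ?_
  rw [mul_pow]; ring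

/-- **Coefficients against the `L¹`-norm on `[x, 4x]`.** -/
theorem coeff_le_box₁ (d : ℕ) : ∃ C : ℝ, 0 < C ∧
    ∀ (c : Fin (d + 1) → ℝ) (i : Fin (d + 1)) (x : ℝ), 0 < x →
      |c i| * x ^ (i : ℕ) * x ≤ C * ∫ ξ in x..4 * x, |pev c ξ| := by
  obtain ⟨C, hC, h⟩ := exists_coeff_le_lone d (by norm_num : (1 : ℝ) < 4)
  refine ⟨C, hC, fun c i x hx => ?_⟩
  have h1 := h (fun j => c j * x ^ (j : ℕ)) i
  have h2 : lone 1 4 (fun j => c j * x ^ (j : ℕ)) = x⁻¹ * ∫ ξ in x..4 * x, |pev c ξ| := by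
    unfold lone
    simp_rw [← pev_scale]
    rw [intervalIntegral.integral_comp_mul_left (fun ξ => |pev c ξ|) hx.ne', smul_eq_mul, mul_one,
      mul_comm x 4]
  rw [h2, abs_mul, abs_of_nonneg (pow_nonneg hx.le _)] at h1
  calc |c i| * x ^ (i : ℕ) * x ≤ C * (x⁻¹ * ∫ ξ in x..4 * x, |pev c ξ|) * x :=
        mul_le_mul_of_nonneg_right h1 hx.le
    _ = C * ∫ ξ in x..4 * x, |pev c ξ| := by field_simp

/-- **Quantitative one-variable monomial split.** For an almost-decreasing weight `w` on
`(0, 4δ)` (constant `K < ∞` at scale `4`) and every coefficient vector `c`: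
`∫_{(0,δ)} |c i| x^i w ≤ A K ∫_{(0,4δ)} |∑ c j x^j| w`, with `A` depending only on `d`. -/
theorem monoSplit₁_le (d : ℕ) : ∃ A : ℝ≥0∞, A ≠ ∞ ∧
    ∀ (c : Fin (d + 1) → ℝ) (w : ℝ → ℝ≥0∞), Measurable w → ∀ (K : ℝ≥0∞), K ≠ ∞ → ∀ δ : ℝ,
      (∀ x x', 0 < x → x ≤ x' → x' ≤ 4 * x → x' < 4 * δ → w x ≤ K * w x') →
      ∀ i : Fin (d + 1), ∫⁻ x in Ioo 0 δ, ENNReal.ofReal (|c i| * x ^ (i : ℕ)) * w x ≤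
        A * K * ∫⁻ x in Ioo 0 (4 * δ), ENNReal.ofReal |pev c x| * w x := by
  obtain ⟨C, hC, hbox⟩ := coeff_le_box₁ d
  refine ⟨ENNReal.ofReal C * ENNReal.ofReal (Real.log 4),
    ENNReal.mul_ne_top ENNReal.ofReal_ne_top ENNReal.ofReal_ne_top, ?_⟩
  intro c w hw K hK δ hmono i
  set G : ℝ → ℝ≥0∞ := fun ξ => ENNReal.ofReal |pev c ξ| * w ξ with hG
  have hGm : Measurable G :=
    (ENNReal.measurable_ofReal.comp (continuous_pev c).abs.measurable).mul hw
  have hpm : Measurable fun ξ => ENNReal.ofReal |pev c ξ| :=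
    ENNReal.measurable_ofReal.comp (continuous_pev c).abs.measurable
  -- pointwise bound
  have hpt : ∀ x ∈ Ioo (0 : ℝ) δ, ENNReal.ofReal (|c i| * x ^ (i : ℕ)) * w x ≤
      ENNReal.ofReal C * K * (ENNReal.ofReal x⁻¹ * ∫⁻ ξ in Ioo x (4 * x), G ξ) := by
    intro x hx
    have h1 : |c i| * x ^ (i : ℕ) ≤ C * (x⁻¹ * ∫ ξ in x..4 * x, |pev c ξ|) := by
      have h := hbox c i x hx.1
      calc |c i| * x ^ (i : ℕ) = |c i| * x ^ (i : ℕ) * x * x⁻¹ := by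
            rw [mul_inv_cancel_right₀ hx.1.ne']
        _ ≤ C * (∫ ξ in x..4 * x, |pev c ξ|) * x⁻¹ :=
            mul_le_mul_of_nonneg_right h (inv_nonneg.2 hx.1.le)
        _ = _ := by ring
    have hR : ENNReal.ofReal (∫ ξ in x..4 * x, |pev c ξ|) =
        ∫⁻ ξ in Ioo x (4 * x), ENNReal.ofReal |pev c ξ| := by
      rw [intervalIntegral.integral_of_le (by linarith [hx.1]),
        ofReal_integral_eq_lintegral_ofReal
          ((continuous_pev c).abs.integrableOn_Icc.mono_set Ioc_subset_Icc_self)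
          (ae_of_all _ fun ξ => abs_nonneg _)]
      exact setLIntegral_congr Ioo_ae_eq_Ioc.symm
    have h3 : (∫⁻ ξ in Ioo x (4 * x), ENNReal.ofReal |pev c ξ|) * w x ≤
        K * ∫⁻ ξ in Ioo x (4 * x), G ξ := by
      calc (∫⁻ ξ in Ioo x (4 * x), ENNReal.ofReal |pev c ξ|) * w x
          = ∫⁻ ξ in Ioo x (4 * x), ENNReal.ofReal |pev c ξ| * w x := (lintegral_mul_const _ hpm).symm
        _ ≤ ∫⁻ ξ in Ioo x (4 * x), ENNReal.ofReal |pev c ξ| * (K * w ξ) :=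
            setLIntegral_mono' measurableSet_Ioo fun ξ hξ =>
              mul_le_mul_right (hmono x ξ hx.1 hξ.1.le hξ.2.le (by linarith [hξ.2, hx.2])) _
        _ = K * ∫⁻ ξ in Ioo x (4 * x), G ξ := by
            rw [← lintegral_const_mul _ hGm]
            exact lintegral_congr fun ξ => by rw [hG]; ring
    calc ENNReal.ofReal (|c i| * x ^ (i : ℕ)) * w x
        ≤ ENNReal.ofReal (C * (x⁻¹ * ∫ ξ in x..4 * x, |pev c ξ|)) * w x :=
          mul_le_mul_left (ENNReal.ofReal_le_ofReal h1) _
      _ = ENNReal.ofReal C * ENNReal.ofReal x⁻¹ *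
            ((∫⁻ ξ in Ioo x (4 * x), ENNReal.ofReal |pev c ξ|) * w x) := by
          rw [ENNReal.ofReal_mul hC.le, ENNReal.ofReal_mul (inv_nonneg.2 hx.1.le), hR]; ring
      _ ≤ ENNReal.ofReal C * ENNReal.ofReal x⁻¹ * (K * ∫⁻ ξ in Ioo x (4 * x), G ξ) :=
          mul_le_mul_right h3 _
      _ = _ := by ring
  have hAK : ENNReal.ofReal C * K ≠ ∞ := ENNReal.mul_ne_top ENNReal.ofReal_ne_top hK
  calc ∫⁻ x in Ioo 0 δ, ENNReal.ofReal (|c i| * x ^ (i : ℕ)) * w x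
      ≤ ∫⁻ x in Ioo 0 δ, ENNReal.ofReal C * K *
          (ENNReal.ofReal x⁻¹ * ∫⁻ ξ in Ioo x (4 * x), G ξ) := setLIntegral_mono' measurableSet_Ioo hpt
    _ = ENNReal.ofReal C * K * ∫⁻ x in Ioo 0 δ, ENNReal.ofReal x⁻¹ * ∫⁻ ξ in Ioo x (4 * x), G ξ :=
        lintegral_const_mul' _ _ hAK
    _ ≤ ENNReal.ofReal C * K * (ENNReal.ofReal (Real.log 4) * ∫⁻ ξ in Ioo 0 (4 * δ), G ξ) :=
        mul_le_mul_right (lintegral_window_le G hGm δ) _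
    _ = _ := by rw [hG]; ring

/-! ### Iterated integrals in three variables -/

/-- Swapping the two outer integrals of a triple iterated integral. -/
theorem iter_swap12 (F : ℝ × ℝ × ℝ → ℝ≥0∞) (hF : Measurable F) (A B C : Set ℝ) :
    ∫⁻ t in A, ∫⁻ v in B, ∫⁻ u in C, F (t, v, u) = ∫⁻ v in B, ∫⁻ t in A, ∫⁻ u in C, F (t, v, u) := by
  have hm : Measurable (Function.uncurry fun t v => ∫⁻ u in C, F (t, v, u)) := by
    have h : Measurable fun q : (ℝ × ℝ) × ℝ => F (q.1.1, q.1.2, q.2) :=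
      hF.comp ((measurable_fst.comp measurable_fst).prodMk
        ((measurable_snd.comp measurable_fst).prodMk measurable_snd))
    exact h.lintegral_prod_right'
  exact lintegral_lintegral_swap hm.aemeasurable

/-- Swapping the two inner integrals of a triple iterated integral. -/
theorem iter_swap23 (F : ℝ × ℝ × ℝ → ℝ≥0∞) (hF : Measurable F) (A B C : Set ℝ) :
    ∫⁻ t in A, ∫⁻ v in B, ∫⁻ u in C, F (t, v, u) = ∫⁻ t in A, ∫⁻ u in C, ∫⁻ v in B, F (t, v, u) := by
  refine lintegral_congr fun t => ?_
  have hm : Measurable (Function.uncurry fun v u => F (t, v, u)) :=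
    hF.comp (measurable_const.prodMk measurable_id)
  exact lintegral_lintegral_swap hm.aemeasurable

/-- Monotonicity of a triple iterated set integral under a pointwise bound on the box. -/
theorem iter_mono {A B C : Set ℝ} (hA : MeasurableSet A) (hB : MeasurableSet B)
    (hC : MeasurableSet C) {f g : ℝ → ℝ → ℝ → ℝ≥0∞}
    (h : ∀ t ∈ A, ∀ v ∈ B, ∀ u ∈ C, f t v u ≤ g t v u) :
    ∫⁻ t in A, ∫⁻ v in B, ∫⁻ u in C, f t v u ≤ ∫⁻ t in A, ∫⁻ v in B, ∫⁻ u in C, g t v u :=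
  setLIntegral_mono' hA fun t ht => setLIntegral_mono' hB fun v hv =>
    setLIntegral_mono' hC fun u hu => h t ht v hv u hu

/-! ### Three variables -/

/-- Coefficient tensors of tridegree `≤ (d, d, d)`. -/
abbrev Coef₃ (d : ℕ) := Fin (d + 1) → Fin (d + 1) → Fin (d + 1) → ℝ

/-- The polynomial function `∑ c i j l t^i v^j u^l`. -/
def pev₃ (c : Coef₃ d) (t v u : ℝ) : ℝ :=
  ∑ i, ∑ j, ∑ l, c i j l * t ^ (i : ℕ) * v ^ (j : ℕ) * u ^ (l : ℕ)

/-- The `u`-coefficients of `pev₃ c t v ·`. -/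
def ucoef (c : Coef₃ d) (t v : ℝ) : Fin (d + 1) → ℝ :=
  fun l => ∑ i, ∑ j, c i j l * t ^ (i : ℕ) * v ^ (j : ℕ)

/-- The `v`-coefficients of the `u`-coefficients. -/
def vcoef (c : Coef₃ d) (t : ℝ) (l : Fin (d + 1)) : Fin (d + 1) → ℝ :=
  fun j => ∑ i, c i j l * t ^ (i : ℕ)

/-- `pev₃` as a polynomial in `u`. -/
theorem pev_ucoef (c : Coef₃ d) (t v u : ℝ) : pev (ucoef c t v) u = pev₃ c t v u := by
  unfold pev ucoef pev₃
  simp_rw [Finset.sum_mul]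
  rw [Finset.sum_comm]
  refine Finset.sum_congr rfl fun i _ => ?_
  rw [Finset.sum_comm]

/-- The `u`-coefficients as polynomials in `v`. -/
theorem pev_vcoef (c : Coef₃ d) (t v : ℝ) (l : Fin (d + 1)) :
    pev (vcoef c t l) v = ucoef c t v l := by
  unfold pev vcoef ucoef
  simp_rw [Finset.sum_mul]
  rw [Finset.sum_comm]

/-- The `v`-coefficients as polynomials in `t`. -/
theorem pev_tcoef (c : Coef₃ d) (t : ℝ) (j l : Fin (d + 1)) :
    pev (fun i => c i j l) t = vcoef c t l j := rfl

/-- `pev₃` is continuous. -/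
theorem continuous_pev₃ (c : Coef₃ d) : Continuous fun p : ℝ × ℝ × ℝ => pev₃ c p.1 p.2.1 p.2.2 := by
  unfold pev₃; fun_prop

/-- `ucoef` is continuous. -/
theorem continuous_ucoef (c : Coef₃ d) (l : Fin (d + 1)) :
    Continuous fun p : ℝ × ℝ => ucoef c p.1 p.2 l := by
  unfold ucoef; fun_prop

/-- `vcoef` is continuous. -/
theorem continuous_vcoef (c : Coef₃ d) (l j : Fin (d + 1)) : Continuous fun t : ℝ => vcoef c t l j := by
  unfold vcoef; fun_prop

/-- **The monomial split under an almost-decreasing weight in three variables.** -/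
theorem monoSplit₃ (c : Coef₃ d) (W : ℝ → ℝ → ℝ → ℝ≥0∞)
    (hW : Measurable fun p : ℝ × ℝ × ℝ => W p.1 p.2.1 p.2.2) (K : ℝ≥0∞) (hK : K ≠ ∞) (δ ε η : ℝ)
    (hmono : ∀ t v u t' v' u', 0 < t → t ≤ t' → t' ≤ 4 * t → t' < 4 * δ → 0 < v → v ≤ v' →
      v' ≤ 4 * v → v' < 4 * ε → 0 < u → u ≤ u' → u' ≤ 4 * u → u' < 4 * η →
      W t v u ≤ K * W t' v' u')
    (hfin : ∫⁻ t in Ioo 0 (4 * δ), ∫⁻ v in Ioo 0 (4 * ε), ∫⁻ u in Ioo 0 (4 * η),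
      ENNReal.ofReal |pev₃ c t v u| * W t v u < ∞) (i j l : Fin (d + 1)) :
    ∫⁻ t in Ioo 0 δ, ∫⁻ v in Ioo 0 ε, ∫⁻ u in Ioo 0 η,
      ENNReal.ofReal (|c i j l| * t ^ (i : ℕ) * v ^ (j : ℕ) * u ^ (l : ℕ)) * W t v u < ∞ := by
  obtain ⟨A, hA, hsplit⟩ := monoSplit₁_le d
  have hAK : A * K ≠ ∞ := ENNReal.mul_ne_top hA hK
  -- measurable building blocks
  have hWt : ∀ t, Measurable (Function.uncurry fun v u => W t v u) := fun t =>
    hW.comp (measurable_const.prodMk measurable_id)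
  have hWtv : ∀ t v, Measurable fun u => W t v u := fun t v =>
    hW.comp (measurable_const.prodMk (measurable_const.prodMk measurable_id))
  have hWtu : ∀ t u, Measurable fun v => W t v u := fun t u =>
    hW.comp (measurable_const.prodMk (measurable_id.prodMk measurable_const))
  have hWvu : ∀ v u, Measurable fun t => W t v u := fun v u =>
    hW.comp (measurable_id.prodMk (measurable_const.prodMk measurable_const))
  -- Step 1: split in `u`
  set F₁ : ℝ × ℝ × ℝ → ℝ≥0∞ := fun p =>
    ENNReal.ofReal (|ucoef c p.1 p.2.1 l| * p.2.2 ^ (l : ℕ)) * W p.1 p.2.1 p.2.2 with hF₁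
  have hF₁m : Measurable F₁ := by
    refine Measurable.mul (ENNReal.measurable_ofReal.comp ?_) hW
    exact (((continuous_ucoef c l).comp (continuous_fst.prodMk (continuous_fst.comp
      continuous_snd))).abs.mul ((continuous_snd.comp continuous_snd).pow _)).measurable
  have h1 : ∫⁻ t in Ioo 0 (4 * δ), ∫⁻ v in Ioo 0 (4 * ε), ∫⁻ u in Ioo 0 η, F₁ (t, v, u) ≤
      A * K * ∫⁻ t in Ioo 0 (4 * δ), ∫⁻ v in Ioo 0 (4 * ε), ∫⁻ u in Ioo 0 (4 * η),
        ENNReal.ofReal |pev₃ c t v u| * W t v u := by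
    rw [← lintegral_const_mul' _ _ hAK]
    refine setLIntegral_mono' measurableSet_Ioo fun t ht => ?_
    rw [← lintegral_const_mul' _ _ hAK]
    refine setLIntegral_mono' measurableSet_Ioo fun v hv => ?_
    have h := hsplit (ucoef c t v) (fun u => W t v u) (hWtv t v) K hK η
      (fun u u' hu huu' hu'u hu' => hmono t v u t v u' ht.1 le_rfl (by linarith [ht.1]) ht.2 hv.1
        le_rfl (by linarith [hv.1]) hv.2 hu huu' hu'u hu') l
    simp only [pev_ucoef] at h
    exact h
  -- Step 2: split in `v`
  set F₂ : ℝ × ℝ × ℝ → ℝ≥0∞ := fun p =>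
    ENNReal.ofReal (|vcoef c p.1 l j| * p.2.1 ^ (j : ℕ) * p.2.2 ^ (l : ℕ)) * W p.1 p.2.1 p.2.2
    with hF₂
  have hF₂m : Measurable F₂ := by
    refine Measurable.mul (ENNReal.measurable_ofReal.comp ?_) hW
    exact ((((continuous_vcoef c l j).comp continuous_fst).abs.mul
      ((continuous_fst.comp continuous_snd).pow _)).mul
      ((continuous_snd.comp continuous_snd).pow _)).measurable
  have h2 : ∫⁻ t in Ioo 0 (4 * δ), ∫⁻ v in Ioo 0 ε, ∫⁻ u in Ioo 0 η, F₂ (t, v, u) ≤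
      A * K * ∫⁻ t in Ioo 0 (4 * δ), ∫⁻ v in Ioo 0 (4 * ε), ∫⁻ u in Ioo 0 η, F₁ (t, v, u) := by
    rw [iter_swap23 F₂ hF₂m, iter_swap23 F₁ hF₁m, ← lintegral_const_mul' _ _ hAK]
    refine setLIntegral_mono' measurableSet_Ioo fun t ht => ?_
    rw [← lintegral_const_mul' _ _ hAK]
    refine setLIntegral_mono' measurableSet_Ioo fun u hu => ?_
    have hu4 : u < 4 * η := by linarith [hu.1, hu.2]
    have hwm : Measurable fun v => ENNReal.ofReal (u ^ (l : ℕ)) * W t v u :=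
      (hWtu t u).const_mul _
    have h := hsplit (vcoef c t l) (fun v => ENNReal.ofReal (u ^ (l : ℕ)) * W t v u) hwm K hK ε
      (fun v v' hv hvv' hv'v hv' => by
        rw [mul_left_comm]
        exact mul_le_mul_right (hmono t v u t v' u ht.1 le_rfl (by linarith [ht.1]) ht.2 hv hvv'
          hv'v hv' hu.1 le_rfl (by linarith [hu.1]) hu4) _) j
    simp only [pev_vcoef] at h
    have hl : ∀ v, F₂ (t, v, u) =
        ENNReal.ofReal (|vcoef c t l j| * v ^ (j : ℕ)) * (ENNReal.ofReal (u ^ (l : ℕ)) * W t v u) := by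
      intro v
      simp only [hF₂]
      rw [ENNReal.ofReal_mul' (pow_nonneg hu.1.le _), mul_assoc]
    have hr : ∀ v, F₁ (t, v, u) =
        ENNReal.ofReal |ucoef c t v l| * (ENNReal.ofReal (u ^ (l : ℕ)) * W t v u) := by
      intro v
      simp only [hF₁]
      rw [ENNReal.ofReal_mul (abs_nonneg _), mul_assoc]
    simp only [hl, hr]
    exact h
  -- Step 3: split in `t`
  set F₃ : ℝ × ℝ × ℝ → ℝ≥0∞ := fun p =>
    ENNReal.ofReal (|c i j l| * p.1 ^ (i : ℕ) * p.2.1 ^ (j : ℕ) * p.2.2 ^ (l : ℕ)) * W p.1 p.2.1 p.2.2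
    with hF₃
  have hF₃m : Measurable F₃ := by
    refine Measurable.mul (ENNReal.measurable_ofReal.comp ?_) hW
    exact ((((continuous_const).mul (continuous_fst.pow _)).mul
      ((continuous_fst.comp continuous_snd).pow _)).mul
      ((continuous_snd.comp continuous_snd).pow _)).measurable
  have hperm : Measurable fun p : ℝ × ℝ × ℝ => (p.2.1, p.1, p.2.2) :=
    (measurable_fst.comp measurable_snd).prodMk
      (measurable_fst.prodMk (measurable_snd.comp measurable_snd))
  have h3 : ∫⁻ t in Ioo 0 δ, ∫⁻ v in Ioo 0 ε, ∫⁻ u in Ioo 0 η, F₃ (t, v, u) ≤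
      A * K * ∫⁻ t in Ioo 0 (4 * δ), ∫⁻ v in Ioo 0 ε, ∫⁻ u in Ioo 0 η, F₂ (t, v, u) :=
    calc ∫⁻ t in Ioo 0 δ, ∫⁻ v in Ioo 0 ε, ∫⁻ u in Ioo 0 η, F₃ (t, v, u)
        = ∫⁻ v in Ioo 0 ε, ∫⁻ t in Ioo 0 δ, ∫⁻ u in Ioo 0 η, F₃ (t, v, u) :=
          iter_swap12 F₃ hF₃m _ _ _
      _ = ∫⁻ v in Ioo 0 ε, ∫⁻ u in Ioo 0 η, ∫⁻ t in Ioo 0 δ, F₃ (t, v, u) :=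
          iter_swap23 (fun p : ℝ × ℝ × ℝ => F₃ (p.2.1, p.1, p.2.2)) (hF₃m.comp hperm) _ _ _
      _ ≤ ∫⁻ v in Ioo 0 ε, ∫⁻ u in Ioo 0 η, A * K * ∫⁻ t in Ioo 0 (4 * δ), F₂ (t, v, u) := by
          refine setLIntegral_mono' measurableSet_Ioo fun v hv =>
            setLIntegral_mono' measurableSet_Ioo fun u hu => ?_
          have hv4 : v < 4 * ε := by linarith [hv.1, hv.2]
          have hu4 : u < 4 * η := by linarith [hu.1, hu.2]
          have hwm : Measurable fun t => ENNReal.ofReal (v ^ (j : ℕ) * u ^ (l : ℕ)) * W t v u :=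
            (hWvu v u).const_mul _
          have h := hsplit (fun i' => c i' j l)
            (fun t => ENNReal.ofReal (v ^ (j : ℕ) * u ^ (l : ℕ)) * W t v u) hwm K hK δ
            (fun t t' ht htt' ht't ht' => by
              rw [mul_left_comm]
              exact mul_le_mul_right (hmono t v u t' v u ht htt' ht't ht' hv.1 le_rfl
                (by linarith [hv.1]) hv4 hu.1 le_rfl (by linarith [hu.1]) hu4) _) i
          have hl : ∀ t, F₃ (t, v, u) = ENNReal.ofReal (|c i j l| * t ^ (i : ℕ)) *
              (ENNReal.ofReal (v ^ (j : ℕ) * u ^ (l : ℕ)) * W t v u) := by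
            intro t
            simp only [hF₃]
            rw [show |c i j l| * t ^ (i : ℕ) * v ^ (j : ℕ) * u ^ (l : ℕ) =
              (|c i j l| * t ^ (i : ℕ)) * (v ^ (j : ℕ) * u ^ (l : ℕ)) by ring,
              ENNReal.ofReal_mul' (mul_nonneg (pow_nonneg hv.1.le _) (pow_nonneg hu.1.le _)),
              mul_assoc]
          have hr : ∀ t, F₂ (t, v, u) = ENNReal.ofReal |pev (fun i' => c i' j l) t| *
              (ENNReal.ofReal (v ^ (j : ℕ) * u ^ (l : ℕ)) * W t v u) := by
            intro t
            simp only [hF₂, pev_tcoef]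
            rw [mul_assoc |vcoef c t l j|, ENNReal.ofReal_mul (abs_nonneg _), mul_assoc]
          simp only [hl, hr]
          exact h
      _ = A * K * ∫⁻ v in Ioo 0 ε, ∫⁻ u in Ioo 0 η, ∫⁻ t in Ioo 0 (4 * δ), F₂ (t, v, u) := by
          rw [← lintegral_const_mul' _ _ hAK]
          refine lintegral_congr fun v => ?_
          rw [← lintegral_const_mul' _ _ hAK]
      _ = A * K * ∫⁻ v in Ioo 0 ε, ∫⁻ t in Ioo 0 (4 * δ), ∫⁻ u in Ioo 0 η, F₂ (t, v, u) := by
          congr 1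
          exact (iter_swap23 (fun p : ℝ × ℝ × ℝ => F₂ (p.2.1, p.1, p.2.2)) (hF₂m.comp hperm)
            _ _ _).symm
      _ = A * K * ∫⁻ t in Ioo 0 (4 * δ), ∫⁻ v in Ioo 0 ε, ∫⁻ u in Ioo 0 η, F₂ (t, v, u) := by
          congr 1
          exact (iter_swap12 F₂ hF₂m _ _ _).symm
  calc ∫⁻ t in Ioo 0 δ, ∫⁻ v in Ioo 0 ε, ∫⁻ u in Ioo 0 η,
      ENNReal.ofReal (|c i j l| * t ^ (i : ℕ) * v ^ (j : ℕ) * u ^ (l : ℕ)) * W t v u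
      = ∫⁻ t in Ioo 0 δ, ∫⁻ v in Ioo 0 ε, ∫⁻ u in Ioo 0 η, F₃ (t, v, u) := rfl
    _ ≤ A * K * (A * K * (A * K * ∫⁻ t in Ioo 0 (4 * δ), ∫⁻ v in Ioo 0 (4 * ε),
        ∫⁻ u in Ioo 0 (4 * η), ENNReal.ofReal |pev₃ c t v u| * W t v u)) :=
        h3.trans (mul_le_mul_right (h2.trans (mul_le_mul_right h1 _)) _)
    _ < ∞ := ENNReal.mul_lt_top hAK.lt_top (ENNReal.mul_lt_top hAK.lt_top
        (ENNReal.mul_lt_top hAK.lt_top hfin))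

end SepHHK

/-- **The monomial split under an almost-decreasing weight in three variables** (registered part
of `stub_separateHigh`, base dimension `3` with fibres; literal form of `SepHHK.monoSplit₃`): if a
measurable weight `W ≥ 0` on `(0, 4δ) × (0, 4ε) × (0, 4η)` is almost decreasing towards the corner
at scale `4` (constant `K < ∞`) and the polynomial `∑ c i' j' l' t^{i'} v^{j'} u^{l'}` is absolutely
`W`-integrable there (iterated lower integrals), then so is every monomial `c i j l t^i v^j u^l`
on `(0, δ) × (0, ε) × (0, η)`. -/
theorem separateThreeHHK_monoSplit (d : ℕ) (c : Fin (d + 1) → Fin (d + 1) → Fin (d + 1) → ℝ) (W : ℝ → ℝ → ℝ → ENNReal) (hW : Measurable fun p : ℝ × ℝ × ℝ => W p.1 p.2.1 p.2.2) (K : ENNReal) (hK : K ≠ ⊤) (δ ε η : ℝ) (hmono : ∀ t v u t' v' u' : ℝ, 0 < t → t ≤ t' → t' ≤ 4 * t → t' < 4 * δ → 0 < v → v ≤ v' → v' ≤ 4 * v → v' < 4 * ε → 0 < u → u ≤ u' → u' ≤ 4 * u → u' < 4 * η → W t v u ≤ K * W t' v' u') (hfin : MeasureTheory.lintegral (MeasureTheory.volume.restrict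 (Set.Ioo 0 (4 * δ))) (fun t => MeasureTheory.lintegral (MeasureTheory.volume.restrict (Set.Ioo 0 (4 * ε))) (fun v => MeasureTheory.lintegral (MeasureTheory.volume.restrict (Set.Ioo 0 (4 * η))) (fun u => ENNReal.ofReal |∑ i' : Fin (d + 1), ∑ j' : Fin (d + 1), ∑ l' : Fin (d + 1), c i' j' l' * t ^ (i' : ℕ) * v ^ (j' : ℕ) * u ^ (l' : ℕ)| * W t v u))) < ⊤) (i j l : Fin (d + 1)) : MeasureTheory.lintegral (MeasureTheory.volume.restrict (Set.Ioo 0 δ)) (fun t => MeasureTheory.lintegral (MeasureTheory.volume.restrict (Set.Ioo 0 ε)) (fun v => MeasureTheory.lintegral (MeasureTheory.volume.restrict (Set.Ioo 0 η)) (fun u => ENNReal.ofReal (|c i j l| * t ^ (i : ℕ) * v ^ (j : ℕ) * u ^ (l : ℕ)) * W t v u))) < ⊤ := by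
  exact SepHHK.monoSplit₃ c W hW K hK δ ε η hmono hfin i j l

end Summit.KontsevichZagierPeriods.ArrangementNormalForm.JanusBands
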